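import Summits.AtomisticToContinuum.HydrodynamicLimit.Theorems.UGibbsSRBRigidityTemperedCollisionsMajorant
import Summits.AtomisticToContinuum.HydrodynamicLimit.Theorems.UGibbsSRBRigidityTemperedCollisionsGibbsWeight
import Summits.AtomisticToContinuum.HydrodynamicLimit.Theorems.JParityClosureOddContactSymmetryGibbsInvariance
import HarnessLib

/-!
# `UGibbsSRBRigidity.TemperedCollisions` (stmt-AtomisticToContinuum-9391), rung 0:
# the tempered collision sum under the homogeneous (flow-invariant) Gibbs law — PROVED

Helper file (`--supports stmt-AtomisticToContinuum-9391`).  The constant-profile instance of the route's support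
item `TemperedCollisions` is proved (`temperedCollisions_const`): for activity `a > 0`, drift `ū`, temperature `θ > 0`,
every `0 < σ < 1/4`, with `C = 4π σ²`, for every `t ≥ 0`, `N` and hard-sphere flow `Φ` of `N + 1` spheres of diameter
`ε_N = σ (N+1)^{-1/3}` on `𝕋³`,
`∫ Σ_{collisions in [0,t]} Σ_{i ≠ j} 𝟙_{contact} ε_N/|⟨n, vᵢ − vⱼ⟩| dG_N ≤ C (1 + t) (N+1)^{4/3}`
— `O(1)` per collision, linear in time, exactly as the item predicts "under the equilibrium flux measure".
Proof: the law-free reduction of step 4; the windows all have the Gibbs mean of the pair sum by invariance of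
`G_N` under every `Φ_t` (`lintegral_comp_flow_localGibbsLaw_const`); step 5 with `B = 2π ε_N² h`; the mesh cancels
(`lintegral_temperedSum_le_const`: `≤ 4π (N+1)² ε_N² τ`); monotonicity in the horizon and
`(N+1)² ε_N² = σ² (N+1)^{4/3}`.

The item as filed (non-constant continuous profiles) is NOT settled by this, see the companion reduction file and
the evidence memo: it needs the one-window pair functionals bounded along the EVOLVED local Gibbs law, uniformly in
`N` — a non-equilibrium input invisible to the order-`N` relative entropy.

References: N. Chernov, J. Stat. Phys. 88 (1997) 1–29, §9; C. Cercignani, R. Illner, M. Pulvirenti (1994), App. 4.A.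
-/

noncomputable section

open MeasureTheory Set Filter Topology
open scoped ENNReal InnerProductSpace

namespace Summit.AtomisticToContinuum.HydrodynamicLimit.Theorems

open Literature.Analysis.FluidPDE Literature.MathematicalPhysics.KineticTheory
open Literature.Analysis.FunctionSpaces

/-! ### Rung 0: the tempered collision sum under the homogeneous Gibbs law -/

/-- The scaling identity `(N+1)² ε_N² = σ² (N+1)^{4/3}` for `ε_N = σ (N+1)^{-1/3}`. [folklore] -/
theorem succ_sq_mul_hsDiameter_sq (σ : ℝ) (N : ℕ) :
    ((N : ℝ) + 1) ^ 2 * hsDiameter σ N ^ 2 = σ ^ 2 * ((N : ℝ) + 1) ^ (4 / 3 : ℝ) := by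
  have hN : (0 : ℝ) < (N : ℝ) + 1 := by positivity
  have hcast : (((N + 1 : ℕ) : ℝ)) = (N : ℝ) + 1 := by push_cast; ring
  rw [hsDiameter, hcast, mul_pow, ← Real.rpow_natCast (((N : ℝ) + 1) ^ (-(1 / 3 : ℝ))) 2,
    ← Real.rpow_mul hN.le]
  have h : ((N : ℝ) + 1) ^ 2 * ((N : ℝ) + 1) ^ (-(1 / 3 : ℝ) * (2 : ℕ)) = ((N : ℝ) + 1) ^ (4 / 3 : ℝ) := by
    rw [← Real.rpow_natCast ((N : ℝ) + 1) 2, ← Real.rpow_add hN]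
    norm_num
  calc ((N : ℝ) + 1) ^ 2 * (σ ^ 2 * ((N : ℝ) + 1) ^ (-(1 / 3 : ℝ) * (2 : ℕ)))
      = σ ^ 2 * (((N : ℝ) + 1) ^ 2 * ((N : ℝ) + 1) ^ (-(1 / 3 : ℝ) * (2 : ℕ))) := by ring
    _ = σ ^ 2 * ((N : ℝ) + 1) ^ (4 / 3 : ℝ) := by rw [h]

/-- **Monotonicity of the collision functional in the horizon** on good orbits: the collision times in
`[0, τ] ⊆ [0, τ']` are finitely many and the marks are nonnegative. [folklore] -/
theorem temperedSum_mono {ε : ℝ} (hε : 0 ≤ ε) {N : ℕ} (Φ : HardSphereFlow (Torus.geometry (Fin 3)) ε N)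
    {z : Config N (Fin 3) T3} (hz : z ∈ Φ.good) {τ τ' : ℝ} (hττ' : τ ≤ τ') :
    (∑ᶠ t ∈ collisionTimes (Torus.geometry (Fin 3)) ε (fun s => Φ.flow s z) ∩ Icc 0 τ,
        ∑ p : Fin N, ∑ q ∈ Finset.univ.erase p,
          (contactSet (Torus.geometry (Fin 3)) N ε p q).indicator
            (fun y : Config N (Fin 3) T3 =>
              ε / |⟪(Torus.geometry (Fin 3)).sepVec (y p).1 (y q).1, (y p).2 - (y q).2⟫_ℝ|) (Φ.flow t z)) ≤
      ∑ᶠ t ∈ collisionTimes (Torus.geometry (Fin 3)) ε (fun s => Φ.flow s z) ∩ Icc 0 τ',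
        ∑ p : Fin N, ∑ q ∈ Finset.univ.erase p,
          (contactSet (Torus.geometry (Fin 3)) N ε p q).indicator
            (fun y : Config N (Fin 3) T3 =>
              ε / |⟪(Torus.geometry (Fin 3)).sepVec (y p).1 (y q).1, (y p).2 - (y q).2⟫_ℝ|) (Φ.flow t z) := by
  have htraj := Φ.isTrajectory z hz
  have hfin : (collisionTimes (Torus.geometry (Fin 3)) ε (fun s => Φ.flow s z) ∩ Icc 0 τ).Finite :=
    htraj.locFinite 0 τ
  have hfin' : (collisionTimes (Torus.geometry (Fin 3)) ε (fun s => Φ.flow s z) ∩ Icc 0 τ').Finite :=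
    htraj.locFinite 0 τ'
  rw [finsum_mem_eq_finite_toFinset_sum _ hfin, finsum_mem_eq_finite_toFinset_sum _ hfin']
  refine Finset.sum_le_sum_of_subset_of_nonneg ?_ fun t _ _ => mark_nonneg hε _
  intro t ht
  rw [Set.Finite.mem_toFinset] at ht ⊢
  exact ⟨ht.1, ht.2.1, ht.2.2.trans hττ'⟩

/-- **The mean tempered collision sum under the homogeneous Gibbs law** (the equilibrium collision-flux
inequality for the mark `1/|ŵ_n|`): for `a, θ > 0`, `0 < σ ≤ 1/4`, every hard-sphere flow `Φ` of `N + 1` spheres of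
diameter `ε_N = σ (N+1)^{-1/3}` on `𝕋³` and every `τ > 0`,
`∫ Σ_{collisions in [0, τ]} Σ_{i ≠ j} 𝟙_{contact} ε_N/|⟨n, vᵢ − vⱼ⟩| dG_N ≤ 4π (N+1)² ε_N² τ = 4π σ² (N+1)^{4/3} τ`
(`lintegral_temperedSum_le_liminf` for the flow-invariant law `G_N`, whose windows all have the Gibbs mean of
the pair sum, `lintegral_comp_flow_localGibbsLaw_const`, `lintegral_pairSum_le`; the mesh cancels exactly).
This is `O(1)` per collision — the collision number being `≍ (N+1)² ε_N² τ E|v − w|` — with no velocity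
moment: under the flux measure `|w_n| d w_n` the inverse normal speed has a finite mean. [folklore] -/
theorem lintegral_temperedSum_le_const {a θ : ℝ} (ha : 0 < a) (hθ : 0 < θ) (ubar : V3) {σ : ℝ}
    (hσ : 0 < σ) (hσ4 : σ ≤ 1 / 4) (N : ℕ)
    (Φ : HardSphereFlow (Torus.geometry (Fin 3)) (hsDiameter σ N) (N + 1)) {τ : ℝ} (hτ : 0 < τ) :
    ∫⁻ z, ENNReal.ofReal (∑ᶠ t ∈ collisionTimes (Torus.geometry (Fin 3)) (hsDiameter σ N)
          (fun s => Φ.flow s z) ∩ Icc 0 τ,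
        ∑ p : Fin (N + 1), ∑ q ∈ Finset.univ.erase p,
          (contactSet (Torus.geometry (Fin 3)) (N + 1) (hsDiameter σ N) p q).indicator
            (fun y : Config (N + 1) (Fin 3) T3 =>
              hsDiameter σ N / |⟪(Torus.geometry (Fin 3)).sepVec (y p).1 (y q).1, (y p).2 - (y q).2⟫_ℝ|)
            (Φ.flow t z)) ∂(localGibbsLaw σ (fun _ => a) (fun _ => ubar) (fun _ => θ) N Φ) ≤
      ENNReal.ofReal (4 * Real.pi * ((N : ℝ) + 1) ^ 2 * hsDiameter σ N ^ 2 * τ) := by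
  have hε0 : 0 < hsDiameter σ N := hsDiameter_pos hσ N
  set P := localGibbsLaw σ (fun _ => a) (fun _ => ubar) (fun _ => θ) N Φ with hP
  have hPeq : P = localGibbsMeasure σ (fun _ => a) (fun _ => ubar) (fun _ => θ) N :=
    localGibbsLaw_eq _ _ _ _ _ _
  have hgood : P Φ.goodᶜ = 0 := by
    rw [hPeq]
    exact localGibbsMeasure_absolutelyContinuous σ _ _ _ N Φ Φ.measure_compl_good
  obtain ⟨g, hgm, hgint, hle⟩ := lintegral_temperedSum_le_liminf hε0 Φ hτ P hgood
  refine hle.trans ?_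
  -- every window has the Gibbs mean of the pair sum
  set R : ℝ≥0∞ := ENNReal.ofReal (4 * Real.pi * ((N : ℝ) + 1) ^ 2 * (hsDiameter σ N) ^ 2 * τ) with hR
  have hmean : ∀ m : ℕ, ∑ k ∈ Finset.range (2 ^ m),
      ∫⁻ z, ∑ p : Fin (N + 1), ∑ q ∈ Finset.univ.erase p,
        g m ((Φ.flow (k * (τ / 2 ^ m)) z p).1 - (Φ.flow (k * (τ / 2 ^ m)) z q).1)
          ((Φ.flow (k * (τ / 2 ^ m)) z p).2 - (Φ.flow (k * (τ / 2 ^ m)) z q).2) ∂P ≤ R := by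
    intro m
    have hk : ∀ k ∈ Finset.range (2 ^ m),
        ∫⁻ z, ∑ p : Fin (N + 1), ∑ q ∈ Finset.univ.erase p,
          g m ((Φ.flow (k * (τ / 2 ^ m)) z p).1 - (Φ.flow (k * (τ / 2 ^ m)) z q).1)
            ((Φ.flow (k * (τ / 2 ^ m)) z p).2 - (Φ.flow (k * (τ / 2 ^ m)) z q).2) ∂P ≤
          2 * ((N : ℝ≥0∞) + 1) ^ 2 * ENNReal.ofReal (2 * Real.pi * (hsDiameter σ N) ^ 2 * (τ / 2 ^ m)) := by
      intro k _
      rw [hP, lintegral_comp_flow_localGibbsLaw_const σ a θ ubar N Φ _ (measurable_pairSum (hgm m)),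
        localGibbsLaw_eq]
      exact lintegral_pairSum_le ha hθ ubar hσ hσ4 N (hgm m) (hgint m)
    calc ∑ k ∈ Finset.range (2 ^ m), ∫⁻ z, ∑ p : Fin (N + 1), ∑ q ∈ Finset.univ.erase p,
          g m ((Φ.flow (k * (τ / 2 ^ m)) z p).1 - (Φ.flow (k * (τ / 2 ^ m)) z q).1)
            ((Φ.flow (k * (τ / 2 ^ m)) z p).2 - (Φ.flow (k * (τ / 2 ^ m)) z q).2) ∂P
        ≤ ∑ _k ∈ Finset.range (2 ^ m),
            2 * ((N : ℝ≥0∞) + 1) ^ 2 * ENNReal.ofReal (2 * Real.pi * (hsDiameter σ N) ^ 2 * (τ / 2 ^ m)) :=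
          Finset.sum_le_sum hk
      _ = R := by
          rw [Finset.sum_const, Finset.card_range, nsmul_eq_mul]
          have h2 : ((2 ^ m : ℕ) : ℝ≥0∞) = ENNReal.ofReal ((2 : ℝ) ^ m) := by
            rw [ENNReal.ofReal_pow (by norm_num), ENNReal.ofReal_ofNat, Nat.cast_pow, Nat.cast_ofNat]
          have hN : ((N : ℝ≥0∞) + 1) ^ 2 = ENNReal.ofReal (((N : ℝ) + 1) ^ 2) := by
            rw [ENNReal.ofReal_pow (by positivity), ENNReal.ofReal_add (by positivity) zero_le_one,
              ENNReal.ofReal_natCast, ENNReal.ofReal_one]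
          rw [h2, hN, hR, show (2 : ℝ≥0∞) = ENNReal.ofReal 2 from (ENNReal.ofReal_ofNat 2).symm,
            ← ENNReal.ofReal_mul (by norm_num), ← ENNReal.ofReal_mul (by positivity),
            ← ENNReal.ofReal_mul (by positivity)]
          congr 1
          field_simp
          ring
  exact liminf_le_of_frequently_le (Eventually.of_forall hmean).frequently

/-- **`TemperedCollisions` at rung 0 (constant profiles).** For activity `a > 0`, drift `ū` and temperature
`θ > 0`, every reduced density `0 < σ < 1/4`, with `C = 4π σ²`: for every `t ≥ 0`, every `N` and every hard-sphere
flow `Φ` of `N + 1` spheres of diameter `σ (N+1)^{-1/3}` on `𝕋³`, the local Gibbs (= homogeneous, flow-invariant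
Gibbs) expectation of the sum over the collisions of the orbit in `[0, t]` of `Σ_{i ≠ j} 𝟙_{contact} ε_N/|⟨n, vᵢ − vⱼ⟩|`
is at most `C (1 + t) (N+1)^{4/3}` — VERBATIM the body of `UGibbsSRBRigidity.TemperedCollisions` with the three
profiles specialised to constants (`lintegral_temperedSum_le_const` at the horizon `t + 1`, monotonicity
`temperedSum_mono`, and `(N+1)² ε_N² = σ² (N+1)^{4/3}`).  The item as filed (non-constant continuous profiles) is
NOT settled by this: the law-free reduction `lintegral_temperedSum_le_liminf` turns it into one-window bounds
ALONG THE EVOLVED local Gibbs law, an N-uniform non-equilibrium input (see the evidence memo on the item).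
[folklore] -/
theorem temperedCollisions_const {a θ : ℝ} (ha : 0 < a) (hθ : 0 < θ) (ubar : V3) :
    ∃ σ₀ : ℝ, 0 < σ₀ ∧ ∀ σ : ℝ, 0 < σ → σ < σ₀ → ∃ C : ℝ, ∀ t : ℝ, 0 ≤ t →
      ∀ (N : ℕ) (Φ : Literature.Analysis.FluidPDE.HardSphereFlow
        (Literature.Analysis.FluidPDE.Torus.geometry (Fin 3))
        (Literature.MathematicalPhysics.KineticTheory.hsDiameter σ N) (N + 1)),
      ∫⁻ z, ENNReal.ofReal (∑ᶠ τ ∈ Literature.Analysis.FluidPDE.collisionTimes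
          (Literature.Analysis.FluidPDE.Torus.geometry (Fin 3))
          (Literature.MathematicalPhysics.KineticTheory.hsDiameter σ N) (fun s => Φ.flow s z) ∩ Set.Icc 0 t,
        ∑ i : Fin (N + 1), ∑ j ∈ Finset.univ.erase i,
          (Literature.Analysis.FluidPDE.contactSet (Literature.Analysis.FluidPDE.Torus.geometry (Fin 3)) (N + 1)
            (Literature.MathematicalPhysics.KineticTheory.hsDiameter σ N) i j).indicator
            (fun y : Literature.Analysis.FluidPDE.Config (N + 1) (Fin 3)
                Literature.MathematicalPhysics.KineticTheory.T3 =>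
              Literature.MathematicalPhysics.KineticTheory.hsDiameter σ N /
                |inner ℝ ((Literature.Analysis.FluidPDE.Torus.geometry (Fin 3)).sepVec (y i).1 (y j).1)
                  ((y i).2 - (y j).2)|) (Φ.flow τ z))
          ∂(Literature.MathematicalPhysics.KineticTheory.localGibbsLaw σ (fun _ => a) (fun _ => ubar)
            (fun _ => θ) N Φ) ≤
        ENNReal.ofReal (C * (1 + t) * ((N : ℝ) + 1) ^ (4 / 3 : ℝ)) := by
  refine ⟨1 / 4, by norm_num, fun σ hσ hσ4 => ⟨4 * Real.pi * σ ^ 2, fun t ht N Φ => ?_⟩⟩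
  have hε0 : 0 < hsDiameter σ N := hsDiameter_pos hσ N
  set P := localGibbsLaw σ (fun _ => a) (fun _ => ubar) (fun _ => θ) N Φ with hP
  have hgood : ∀ᵐ z ∂P, z ∈ Φ.good := by
    have h0 : P Φ.goodᶜ = 0 := by
      rw [hP, localGibbsLaw_eq]
      exact localGibbsMeasure_absolutelyContinuous σ _ _ _ N Φ Φ.measure_compl_good
    exact ae_iff.2 h0
  -- monotonicity in the horizon: `[0, t] ⊆ [0, t + 1]`, then the rung-0 mean bound at the horizon `t + 1`
  have hmain := lintegral_temperedSum_le_const ha hθ ubar hσ hσ4.le N Φ (τ := t + 1) (by linarith)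
  refine le_trans (lintegral_mono_ae ?_) (hmain.trans ?_)
  · filter_upwards [hgood] with z hz
    exact ENNReal.ofReal_le_ofReal (temperedSum_mono hε0.le Φ hz (by linarith))
  · refine ENNReal.ofReal_le_ofReal (le_of_eq ?_)
    have h := succ_sq_mul_hsDiameter_sq σ N
    calc 4 * Real.pi * ((N : ℝ) + 1) ^ 2 * hsDiameter σ N ^ 2 * (t + 1)
        = 4 * Real.pi * (((N : ℝ) + 1) ^ 2 * hsDiameter σ N ^ 2) * (1 + t) := by ring
      _ = 4 * Real.pi * σ ^ 2 * (1 + t) * ((N : ℝ) + 1) ^ (4 / 3 : ℝ) := by rw [h]; ring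


end Summit.AtomisticToContinuum.HydrodynamicLimit.Theorems

end
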